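import Summits.QuantumFields.GaugeBoot.DiagonalRPTorusOddZigzag
import HarnessLib

/-!
# Diagonal RP on the ODD two-dimensional torus, II: the fibrewise vertex action on the middle
zigzag and the swap off the zigzag (gauge-boot, task L3(θ))

HONEST FRAMING (cell `pub-gaugeboot`, page 1 of every file): the venture produces certified bounds
on lattice expectations at stated coupling, gauge group, dimension and torus size; NOT a mass gap,
NOT a continuum limit, NOT a string tension; NOT Yang–Mills-summit-bearing (barriers
`FixedCouplingUltralocality`, `PerturbativeInvisibility`). This module is part of a small POSITIVE
structural result about which positivity constraints a two-dimensional TORUS certificate may use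
(no two-dimensional certificate with a diagonal block exists or is planned); it discharges nothing
else.

Continuation of `DiagonalRPTorusOddZigzag.lean` (notation there: odd `L = 2c + 1`, the middle
zigzag `ZM` between the layers `c` and `c + 1`, its sites `A_t = mA i t`, `B_t = A_t + e_i`, the
rotation gauge `ohfun`).

* `zigM i j h U` — the FIBREWISE vertex action of a site function `h` on the middle zigzag
  (gauge-transform the zigzag links only; NOT a gauge transformation of the torus), multiplicative
  (`zigM_mul`), splitting into the commuting actions at the layer-`c` vertices (`onB`, from
  `DiagonalRPTorusTwoZigzagAction.lean`) and at the layer-`(c+1)` vertices (`onC`)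
  (`zigM_eq_zigM_onB_onC`, `zigM_onB_onC_comm`), and conjugated by the swap into itself with the
  two layers exchanged (`configDiagSwap_zigM`, `onB_comp_siteDiagSwap`, `onC_comp_siteDiagSwap`).
* `configOddSwap i j` (`Θ″`) — the swap OFF the middle zigzag, the identity ON it: an involutive
  relabelling of the links (`oddSigma`, `oddSigma_oddSigma`) fixing the zigzag links, and
  **`configDiagSwap_eq_zigM_configOddSwap`: `Θ U = zigM (h(U)) (Θ″ U)`** — the swap IS `Θ″`
  followed by a (field-dependent) fibrewise vertex gauge transformation of the middle zigzag
  (`gauge_mA` / `gauge_mB` of the previous module).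
* The links of the middle zigzag as a `Finset` (`zmLinks`), disjoint from the links of the closed
  half (`disjoint_zmLinks_halfLinks`); the links of a layer-`c` plaquette lie in the closed half or
  on the zigzag (`blk_subset_of_kd_eq_cc`).
* How the plaquette terms see the action: mirror plaquettes not at all (`rr_zigM_of_kd_eq_zero`),
  the transport `D_y` of a layer-`c` plaquette not at all (`dT_zigM_of_kd_eq_cc`), its transport
  `C_y` by conjugation at its two layer-`c` ends (`cT_zigM_of_kd_eq_cc`), so that a layer-`c`
  plaquette term is invariant under the layer-`(c+1)` action (`rr_zigM_onC_of_kd_eq_cc`).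

Continued in `DiagonalRPTorusOddAverage.lean`, `DiagonalRPTorusOddCrossing.lean` and
`DiagonalRPTorusOdd.lean`. All statements are elementary and proved (E. Seiler, LNP 159 (1982)
Ch. 2 for the vertex gauge action).
-/

open MeasureTheory Complex Finset Function
open scoped ComplexOrder ENNReal

namespace Summit.QuantumFields.GaugeBoot

open Literature.MathematicalPhysics.QuantumFieldTheory

noncomputable section

namespace DiagRPTwo

/-! ## The fibrewise vertex action on the middle zigzag -/

section Zig

variable {L : ℕ} {i j : Fin 2} {G : Type*} [Group G]

variable (i j) in
/-- The fibrewise vertex action of a site function `h` on the middle zigzag: gauge-transform the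
zigzag links, leave every other link fixed. -/
def zigM (h : Site 2 L → G) (U : GaugeConfig 2 L G) : GaugeConfig 2 L G :=
  fun e => if ZM i j e then gaugeTransform h U e else U e

/-- The action on a zigzag link. -/
theorem zigM_apply_of_zm (h : Site 2 L → G) (U : GaugeConfig 2 L G) {e : Edge 2 L}
    (he : ZM i j e) : zigM i j h U e = h e.1 * U e * (h (e.1.shift e.2))⁻¹ := by
  simp only [zigM, if_pos he, gaugeTransform]

/-- The action does not touch the other links. -/
theorem zigM_apply_of_not_zm (h : Site 2 L → G) (U : GaugeConfig 2 L G) {e : Edge 2 L}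
    (he : ¬ZM i j e) : zigM i j h U e = U e := by
  simp only [zigM, if_neg he]

/-- The action is multiplicative in the site function. -/
theorem zigM_mul (k h : Site 2 L → G) (U : GaugeConfig 2 L G) :
    zigM i j (k * h) U = zigM i j k (zigM i j h U) := by
  funext e
  by_cases he : ZM i j e
  · simp only [zigM_apply_of_zm _ _ he, Pi.mul_apply, mul_inv_rev, mul_assoc]
  · simp only [zigM_apply_of_not_zm _ _ he]

/-- The value of the image on a link depends only on the value of the configuration there. -/
theorem zigM_apply_congr (h : Site 2 L → G) {U V : GaugeConfig 2 L G} {e : Edge 2 L}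
    (hUV : U e = V e) : zigM i j h U e = zigM i j h V e := by
  by_cases he : ZM i j e
  · rw [zigM_apply_of_zm _ _ he, zigM_apply_of_zm _ _ he, hUV]
  · rw [zigM_apply_of_not_zm _ _ he, zigM_apply_of_not_zm _ _ he, hUV]

/-- A function depending on a set of links, composed with the action, depends on the same links. -/
theorem dependsOn_comp_zigM {α : Type*} {g : GaugeConfig 2 L G → α} {S : Set (Edge 2 L)}
    (hg : DependsOn g S) (h : Site 2 L → G) : DependsOn (fun U => g (zigM i j h U)) S :=
  fun _ _ hUV => hg fun e he => zigM_apply_congr h (hUV e he)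

variable (i j) in
/-- Restriction of a site function to the layer `c + 1` (value `1` elsewhere); the restriction to
the layer `c` is `onB` of `DiagonalRPTorusTwoZigzagAction.lean`. -/
def onC (k : Site 2 L → G) : Site 2 L → G := fun y => if kd i j y = cc L + 1 then k y else 1

/-- `onC` on the layer `c + 1`. -/
theorem onC_of_eq (k : Site 2 L → G) {y : Site 2 L} (hy : kd i j y = cc L + 1) : onC i j k y = k y :=
  if_pos hy

/-- `onC` off the layer `c + 1`. -/
theorem onC_of_ne (k : Site 2 L → G) {y : Site 2 L} (hy : kd i j y ≠ cc L + 1) : onC i j k y = 1 :=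
  if_neg hy

/-- `onB` is multiplicative. -/
theorem onB_mul (k h : Site 2 L → G) : onB i j (k * h) = onB i j k * onB i j h := by
  funext y
  by_cases hy : kd i j y = cc L
  · simp only [Pi.mul_apply, onB_of_eq _ hy]
  · simp only [Pi.mul_apply, onB_of_ne _ hy, mul_one]

/-- `onC` is multiplicative. -/
theorem onC_mul (k h : Site 2 L → G) : onC i j (k * h) = onC i j k * onC i j h := by
  funext y
  by_cases hy : kd i j y = cc L + 1
  · simp only [Pi.mul_apply, onC_of_eq _ hy]
  · simp only [Pi.mul_apply, onC_of_ne _ hy, mul_one]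

/-- The two restrictions commute pointwise (`L ≥ 3`). -/
theorem onB_mul_onC_comm (h3 : 3 ≤ L) (k k' : Site 2 L → G) :
    onB i j k * onC i j k' = onC i j k' * onB i j k := by
  funext y
  by_cases hB : kd i j y = cc L
  · have hC : kd i j y ≠ cc L + 1 := fun h => cc_add_one_ne_cc h3 (h.symm.trans hB)
    simp only [Pi.mul_apply, onB_of_eq _ hB, onC_of_ne _ hC, mul_one, one_mul]
  · simp only [Pi.mul_apply, onB_of_ne _ hB, mul_one, one_mul]

/-- The two actions commute (`L ≥ 3`). -/
theorem zigM_onB_onC_comm (h3 : 3 ≤ L) (k k' : Site 2 L → G) (U : GaugeConfig 2 L G) :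
    zigM i j (onB i j k) (zigM i j (onC i j k') U) = zigM i j (onC i j k') (zigM i j (onB i j k) U) := by
  rw [← zigM_mul, ← zigM_mul, onB_mul_onC_comm h3]

/-- The action of a site function is the composite of its actions at the two layers (`L ≥ 3`). -/
theorem zigM_eq_zigM_onB_onC (h3 : 3 ≤ L) (hij : i ≠ j) (h : Site 2 L → G) (U : GaugeConfig 2 L G) :
    zigM i j h U = zigM i j (onB i j h) (zigM i j (onC i j h) U) := by
  rw [← zigM_mul]
  funext e
  by_cases he : ZM i j e
  · have hcc : cc L ≠ cc L + 1 := fun h => cc_add_one_ne_cc h3 h.symm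
    rw [zigM_apply_of_zm _ _ he, zigM_apply_of_zm _ _ he]
    rcases zm_layers hij he with ⟨h1, h2⟩ | ⟨h1, h2⟩
    · have h2' : kd i j (e.1.shift e.2) ≠ cc L := by rw [h2]; exact cc_add_one_ne_cc h3
      simp only [Pi.mul_apply, onB_of_eq _ h1, onC_of_ne _ (by rw [h1]; exact hcc), onB_of_ne _ h2',
        onC_of_eq _ h2, mul_one, one_mul]
    · have h1' : kd i j e.1 ≠ cc L := by rw [h1]; exact cc_add_one_ne_cc h3
      simp only [Pi.mul_apply, onB_of_ne _ h1', onC_of_eq _ h1, onB_of_eq _ h2,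
        onC_of_ne _ (by rw [h2]; exact hcc), mul_one, one_mul]
  · rw [zigM_apply_of_not_zm _ _ he, zigM_apply_of_not_zm _ _ he]

/-- `onB (k ∘ θ) = (onC k) ∘ θ` (odd `L`): the swap exchanges the two layers. -/
theorem onB_comp_siteDiagSwap (hL : Odd L) (k : Site 2 L → G) :
    onB i j (k ∘ siteDiagSwap i j) = onC i j k ∘ siteDiagSwap i j := by
  funext y
  have hiff : kd i j y = cc L ↔ kd i j (siteDiagSwap i j y) = cc L + 1 := by
    rw [kd_siteDiagSwap, neg_eq_iff_eq_neg, neg_cc_add_one_odd hL]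
  by_cases hy : kd i j y = cc L
  · rw [Function.comp_apply, onB_of_eq _ hy, onC_of_eq _ (hiff.1 hy), Function.comp_apply]
  · rw [Function.comp_apply, onB_of_ne _ hy, onC_of_ne _ fun h => hy (hiff.2 h)]

/-- `onC (k ∘ θ) = (onB k) ∘ θ` (odd `L`). -/
theorem onC_comp_siteDiagSwap (hL : Odd L) (k : Site 2 L → G) :
    onC i j (k ∘ siteDiagSwap i j) = onB i j k ∘ siteDiagSwap i j := by
  funext y
  have hiff : kd i j y = cc L + 1 ↔ kd i j (siteDiagSwap i j y) = cc L := by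
    rw [kd_siteDiagSwap, neg_eq_iff_eq_neg, neg_cc_odd hL]
  by_cases hy : kd i j y = cc L + 1
  · rw [Function.comp_apply, onC_of_eq _ hy, onB_of_eq _ (hiff.1 hy), Function.comp_apply]
  · rw [Function.comp_apply, onC_of_ne _ hy, onB_of_ne _ fun h => hy (hiff.2 h)]

/-- **The swap conjugates the fibrewise action into itself**: `Θ ∘ zigM_h = zigM_{h ∘ θ} ∘ Θ`
(odd `L`). -/
theorem configDiagSwap_zigM (hL : Odd L) (hij : i ≠ j) (h : Site 2 L → G) (U : GaugeConfig 2 L G) :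
    configDiagSwap i j (zigM i j h U) = zigM i j (h ∘ siteDiagSwap i j) (configDiagSwap i j U) := by
  funext e
  by_cases he : ZM i j e
  · have he' : ZM i j (edgeDiagSwap i j e) := (zm_edgeDiagSwap_iff hL hij e).2 he
    rw [configDiagSwap, zigM_apply_of_zm _ _ he', zigM_apply_of_zm _ _ he]
    simp only [configDiagSwap, edgeDiagSwap, Function.comp_apply, siteDiagSwap_shift]
  · have he' : ¬ZM i j (edgeDiagSwap i j e) := fun h' => he ((zm_edgeDiagSwap_iff hL hij e).1 h')
    rw [configDiagSwap, zigM_apply_of_not_zm _ _ he', zigM_apply_of_not_zm _ _ he, configDiagSwap]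

end Zig

/-! ## The swap off the middle zigzag and the key identity -/

section OddSwap

variable {L : ℕ} {i j : Fin 2} {G : Type*}

variable (i j) in
/-- The relabelling of links underlying `Θ″`: the swap off the middle zigzag, the identity on it. -/
def oddSigma (e : Edge 2 L) : Edge 2 L := if ZM i j e then e else edgeDiagSwap i j e

/-- `oddSigma` is an involution (odd `L`). -/
theorem oddSigma_oddSigma (hL : Odd L) (hij : i ≠ j) (e : Edge 2 L) :
    oddSigma i j (oddSigma i j e) = e := by
  by_cases he : ZM i j e
  · simp only [oddSigma, if_pos he]
  · have he' : ¬ZM i j (edgeDiagSwap i j e) := fun h => he ((zm_edgeDiagSwap_iff hL hij e).1 h)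
    simp only [oddSigma, if_neg he, if_neg he', edgeDiagSwap_edgeDiagSwap]

variable (i j) in
/-- `Θ″`: the swap OFF the middle zigzag, the identity ON it, `(Θ″U)(e) = U(oddSigma e)`. -/
def configOddSwap (U : GaugeConfig 2 L G) : GaugeConfig 2 L G := fun e => U (oddSigma i j e)

/-- `Θ″` fixes the zigzag links. -/
theorem configOddSwap_apply_of_zm (U : GaugeConfig 2 L G) {e : Edge 2 L} (he : ZM i j e) :
    configOddSwap i j U e = U e := by
  simp only [configOddSwap, oddSigma, if_pos he]

/-- `Θ″` is the swap off the zigzag. -/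
theorem configOddSwap_apply_of_not_zm (U : GaugeConfig 2 L G) {e : Edge 2 L} (he : ¬ZM i j e) :
    configOddSwap i j U e = U (edgeDiagSwap i j e) := by
  simp only [configOddSwap, oddSigma, if_neg he]

/-- `Θ″` is an involution (odd `L`). -/
theorem configOddSwap_configOddSwap (hL : Odd L) (hij : i ≠ j) (U : GaugeConfig 2 L G) :
    configOddSwap i j (configOddSwap i j U) = U :=
  funext fun e => by simp only [configOddSwap, oddSigma_oddSigma hL hij]

variable [Group G]

/-- **The swap is `Θ″` followed by the rotation gauge of the middle zigzag**:
`Θ U = zigM (h(U)) (Θ″ U)` (odd `L ≥ 3`). -/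
theorem configDiagSwap_eq_zigM_configOddSwap [NeZero L] (hL : Odd L) (h3 : 3 ≤ L) (hij : i ≠ j)
    (U : GaugeConfig 2 L G) :
    configDiagSwap i j U = zigM i j (ohfun i j U) (configOddSwap i j U) := by
  funext e
  by_cases he : ZM i j e
  · rw [zigM_apply_of_zm _ _ he, configOddSwap_apply_of_zm _ he, configDiagSwap]
    rcases exists_eq_of_zm hij he with h | h <;> rw [h]
    · exact (gauge_mA hL h3 hij U _).symm
    · exact (gauge_mB hL h3 hij U _).symm
  · rw [zigM_apply_of_not_zm _ _ he, configOddSwap_apply_of_not_zm _ he, configDiagSwap]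

end OddSwap

/-! ## The zigzag links as a finite set; links of the layer-`c` plaquettes -/

section Links

variable {L : ℕ} [NeZero L] {i j : Fin 2}

variable (i j) in
/-- The links of the middle zigzag. -/
def zmLinks : Finset (Edge 2 L) := univ.filter (ZM i j)

/-- Membership in `zmLinks`. -/
@[simp] theorem mem_zmLinks {e : Edge 2 L} : e ∈ zmLinks (L := L) i j ↔ ZM i j e := by
  simp [zmLinks]

/-- The zigzag links are disjoint from the links of the closed half (`L ≥ 3`). -/
theorem disjoint_zmLinks_halfLinks (h3 : 3 ≤ L) (hij : i ≠ j) :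
    Disjoint (zmLinks (L := L) i j) (halfLinks i j) :=
  Finset.disjoint_left.2 fun _ he hh => not_inHalf_of_zm h3 hij (mem_zmLinks.1 he) (mem_halfLinks.1 hh)

/-- Membership in the layer `c` in terms of representatives (every `L ≥ 1`). -/
theorem kd_eq_cc_iff' (y : Site 2 L) : kd i j y = cc L ↔ (kd i j y).val = L / 2 := by
  rw [← cc_val' (L := L)]
  exact ⟨fun h => by rw [h], fun h => ZMod.val_injective L h⟩

/-- The two links of `D_y` for `y` in the layer `c` are links of the closed half (`L ≥ 3`). -/
theorem inHalf_dT_links' (h3 : 3 ≤ L) (hij : i ≠ j) {y : Site 2 L} (hy : kd i j y = cc L) :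
    InHalf i j (y, j) ∧ InHalf i j (y.shift j, i) := by
  have hv : (kd i j y).val = L / 2 := by rw [hy, cc_val']
  have hv1 : (kd i j (y.shift j)).val = L / 2 - 1 := by
    rw [kd_shift_right hij, hy, val_cc_sub_one' h3]
  have hv2 : kd i j ((y.shift j).shift i) = kd i j y := by
    rw [kd_shift_left hij, kd_shift_right hij]; ring
  refine ⟨⟨by simp only [hv]; exact le_rfl, by simp only [hv1]; omega⟩,
    ⟨by simp only [hv1]; omega, by simp only [hv2, hv]; exact le_rfl⟩⟩

/-- The four links of a layer-`c` plaquette are links of the closed half or of the zigzag. -/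
theorem blk_subset_of_kd_eq_cc (h3 : 3 ≤ L) (hij : i ≠ j) {y : Site 2 L} (hy : kd i j y = cc L) :
    ((blk i j y : Finset (Edge 2 L)) : Set (Edge 2 L)) ⊆
      ((halfLinks i j ∪ zmLinks (L := L) i j : Finset (Edge 2 L)) : Set (Edge 2 L)) := by
  intro e he
  rw [Finset.coe_union, Set.mem_union, Finset.mem_coe, Finset.mem_coe, mem_halfLinks, mem_zmLinks]
  obtain ⟨h1, h2⟩ := inHalf_dT_links' h3 hij hy
  rcases mem_blk.1 (Finset.mem_coe.1 he) with rfl | rfl | rfl | rfl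
  · exact Or.inr (Or.inl ⟨rfl, hy⟩)
  · exact Or.inr (Or.inr ⟨rfl, by rw [kd_shift_left hij, hy]⟩)
  · exact Or.inl h1
  · exact Or.inl h2

end Links

/-! ## How the plaquette terms see the action -/

section Invariance

variable {L N : ℕ} {i j : Fin 2} {G : Type*} [Group G] (ρ : G →* Matrix (Fin N) (Fin N) ℂ)

/-- The links of a mirror plaquette are not zigzag links (`L ≥ 3`). -/
theorem not_zm_of_mem_blk_of_kd_eq_zero (h3 : 3 ≤ L) (hij : i ≠ j) {y : Site 2 L}
    (hy : kd i j y = 0) {e : Edge 2 L} (he : e ∈ blk i j y) : ¬ZM i j e := by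
  have hi : kd i j (y.shift i) = 1 := by rw [kd_shift_left hij, hy, zero_add]
  have hj : kd i j (y.shift j) = -1 := by rw [kd_shift_right hij, hy, zero_sub]
  have h0 : (0 : ZMod L) ≠ cc L := fun h => cc_ne_zero' h3 h.symm
  have h0' : (0 : ZMod L) ≠ cc L + 1 := fun h => cc_add_one_ne_zero h3 h.symm
  have h1 : (1 : ZMod L) ≠ cc L + 1 := fun h => cc_ne_zero' h3 (by simpa using h.symm)
  have hm1 : (-1 : ZMod L) ≠ cc L := fun h => by
    have h' : cc L + 1 = 0 := by rw [← h, neg_add_cancel]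
    exact cc_add_one_ne_zero h3 h'
  rw [mem_blk] at he
  rcases he with rfl | rfl | rfl | rfl <;> rintro (⟨hμ, h⟩ | ⟨hμ, h⟩) <;>
    simp only [hy, hi, hj, hij, hij.symm] at hμ h <;>
    first | exact h0 h | exact h0' h | exact h1 h | exact hm1 h

/-- A mirror plaquette term does not see the action (`L ≥ 3`). -/
theorem rr_zigM_of_kd_eq_zero (h3 : 3 ≤ L) (hij : i ≠ j) (h : Site 2 L → G) (U : GaugeConfig 2 L G)
    {y : Site 2 L} (hy : kd i j y = 0) : rr ρ i j (zigM i j h U) y = rr ρ i j U y :=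
  dependsOn_blk i j y (fun c d => ((ρ (c * d⁻¹)).trace).re) fun _ he =>
    zigM_apply_of_not_zm _ _ (not_zm_of_mem_blk_of_kd_eq_zero h3 hij hy he)

/-- The transport `D_y` of a layer-`c` plaquette does not see the action (its links run between
the layers `c` and `c - 1`; `L ≥ 3`). -/
theorem dT_zigM_of_kd_eq_cc (h3 : 3 ≤ L) (hij : i ≠ j) (h : Site 2 L → G) (U : GaugeConfig 2 L G)
    {y : Site 2 L} (hy : kd i j y = cc L) : dT i j (zigM i j h U) y = dT i j U y := by
  have hm : kd i j (y.shift j) = cc L - 1 := by rw [kd_shift_right hij, hy]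
  have h1 : ¬ZM i j (y, j) := by
    rintro (⟨hμ, _⟩ | ⟨_, hk⟩)
    · exact hij.symm hμ
    · exact cc_add_one_ne_cc h3 (hk.symm.trans hy)
  have h2 : ¬ZM i j (y.shift j, i) := by
    rintro (⟨_, hk⟩ | ⟨hμ, _⟩)
    · rw [hm] at hk
      haveI := nontrivial_zmod_of_three_le h3
      exact absurd (by simpa using congrArg (fun z => cc L - z) hk : (1 : ZMod L) = 0) one_ne_zero
    · exact hij hμ
  rw [dT, dT, zigM_apply_of_not_zm _ _ h1, zigM_apply_of_not_zm _ _ h2]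

/-- The transport `C_y` of a layer-`c` plaquette is conjugated at its two layer-`c` ends. -/
theorem cT_zigM_of_kd_eq_cc (hij : i ≠ j) (h : Site 2 L → G) (U : GaugeConfig 2 L G)
    {y : Site 2 L} (hy : kd i j y = cc L) :
    cT i j (zigM i j h U) y = h y * cT i j U y * (h ((y.shift i).shift j))⁻¹ := by
  have h1 : ZM i j (y, i) := Or.inl ⟨rfl, hy⟩
  have h2 : ZM i j (y.shift i, j) := Or.inr ⟨rfl, by rw [kd_shift_left hij, hy]⟩
  rw [cT, cT, zigM_apply_of_zm _ _ h1, zigM_apply_of_zm _ _ h2]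
  simp only [mul_assoc, inv_mul_cancel_left]

/-- **A layer-`c` plaquette term is invariant under the layer-`(c+1)` action** (`L ≥ 3`). -/
theorem rr_zigM_onC_of_kd_eq_cc (h3 : 3 ≤ L) (hij : i ≠ j) (k : Site 2 L → G)
    (U : GaugeConfig 2 L G) {y : Site 2 L} (hy : kd i j y = cc L) :
    rr ρ i j (zigM i j (onC i j k) U) y = rr ρ i j U y := by
  have hy' : kd i j ((y.shift i).shift j) = cc L := by
    rw [kd_shift_right hij, kd_shift_left hij, hy, add_sub_cancel_right]
  have hne : cc L ≠ cc L + 1 := fun h => cc_add_one_ne_cc h3 h.symm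
  rw [rr, rr, cT_zigM_of_kd_eq_cc hij _ U hy, dT_zigM_of_kd_eq_cc h3 hij _ U hy,
    onC_of_ne k (show kd i j y ≠ cc L + 1 by rw [hy]; exact hne),
    onC_of_ne k (show kd i j ((y.shift i).shift j) ≠ cc L + 1 by rw [hy']; exact hne), one_mul,
    inv_one, mul_one]

/-- Under a general site function a layer-`c` plaquette term is conjugated:
`r_y(zigM_h U) = Re tr ρ(h(y) C_y h(y')⁻¹ D_y⁻¹)`, `y' = y + e_i + e_j`. -/
theorem rr_zigM_of_kd_eq_cc (h3 : 3 ≤ L) (hij : i ≠ j) (h : Site 2 L → G) (U : GaugeConfig 2 L G)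
    {y : Site 2 L} (hy : kd i j y = cc L) :
    rr ρ i j (zigM i j h U) y =
      ((ρ (h y * cT i j U y * (h ((y.shift i).shift j))⁻¹ * (dT i j U y)⁻¹)).trace).re := by
  rw [rr, cT_zigM_of_kd_eq_cc hij h U hy, dT_zigM_of_kd_eq_cc h3 hij h U hy]

end Invariance

end DiagRPTwo

end

end Summit.QuantumFields.GaugeBoot
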